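import Literature.MathematicalPhysics.QuantumLattice.TypeClassSidecarReaderFillingBox
import Literature.MathematicalPhysics.QuantumLattice.TorusSectorPressureTypeBoundParticleHole
import HarnessLib

/-!
# The filling leg of the sidecar reader on the ELECTRON-DOPED side: two checked types on the REFLECTED skeleton of a
# HOLE-doped sidecar word every electron density between them, on EVERY torus (no parity), jointly with the `(t', U)`-box

Family `hubbard` (topic `MathematicalPhysics/QuantumLattice`), seat hubbard-downfold-unc-2 (FILLING direction of «a parameter BOX maps to a
certified word»; electron-doped half). `TypeClassSidecarReaderFillingBox` words a `(t', U, n)`-cell from ONE sidecar of `H^open_{a×b}(t, s₀, U₀)`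
and two checked types; the electron-doped validation materials (NCCO, SLCO; `t' < 0`, `n > 1`) have no sidecar of their own, but the open cluster is
bipartite for ANY sides, so the certified HOLE-doped sidecar of `H^open(t, −s₀, U₀)` in the sectors `(ab − p, ab − q)` IS a floor for the
electron-doped sectors `(p, q)` of `H^open(t, s₀, U₀)` with the factor `e^{βU₀(ab − p − q)}` (`TorusSectorPressureTypeBoundParticleHole`,
this seat). Hence a row list written in ELECTRON-side sector coordinates `(p, q)` whose skeleton floors are the hole-doped sidecar's floors at
`(ab − p, ab − q)` passes the same `c2Check`, and its claim node is the hole-doped node read at the reflected sectors. This file composes: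

* §1 `eventually_pressureFloor_chord_of_c2Check₂_particleHole[_of_mem_Icc]`: two such checked types (densities `ρ₁ < ρ₂`, typically `> 1`)
  with a common skeleton give, along ANY `Ls → ∞` (no parity condition on the tori),
  `∀ ε > 0, ∀ᶠ j, (((W₁ + (n−ρ₁)/(ρ₂−ρ₁)(W₂−W₁)) + βU₀(1 − n)) − ε)(Ls j)² ≤ log Re Z_β(sectorHamiltonianTT' t s₀ U₀ n (Ls j))` for every
  `n ∈ [ρ₁, ρ₂]` — the chord of the two type values plus the exact free-energy image `βU₀(1 − n)` of the Hartree shift `U(n − 1)`;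
* §2 the electron-doped 3-CELL READER (one anchor `(s₀, U₀)`, `t' = 0` corner/rect Markov certificate at `(β_h, μ, U₀)` — a grand-canonical
  bound, valid in every sector, electron-doped included): for every torus limit at `(β, t, s, U, n)` with `|s| ≤ σ₁`, `|s − s₀| ≤ σ₂`, `ρ₁ ≤ n ≤ ρ₂ < 2`:
  `e_Φ(ω) ≤ ((((c − β_hμn) + β_hσ₁K) + β_h·max(U₀−U,0)·n/2) − ((((W₁ + (n−ρ₁)/(ρ₂−ρ₁)(W₂−W₁)) + βU₀(1−n)) − βσ₂K) − β·max(U−U₀,0)·n/2))/(β−β_h)`,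
  `K = 16/π²` (decimal edition `16212/10000`).

Compared with the state-level particle–hole transport of caps (`TorusSectorGibbsParticleHole`, even tori only, one density with `nL²/2 ∈ ℤ`
along the sides), this route has NO parity restriction and covers a filling INTERVAL. Everything is PROVED; no definition, no named fact, no
number. HONEST SCOPE: kinematic `t'`/`U` prices as in the hole-doped reader; the chord lies below the optimal type at interior densities.
WHAT THIS IS NOT: no certificate, no phase sentence.

## Mathlib / tree search

REUSED: `c2Check_sound`, `c2Floor_le_of_rows`, `c2Sectors_eq_of_skeleton_eq`, `c2Floor_eq_of_skeleton_eq` (`TypeClassSidecarReader[FillingBox]`);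
`InfVolFermionState.eventually_typeFreeEntropy_chord_mul_sq_le_log_partitionFn_allTori` (`TorusSectorPressureTypeBoundFillingBox`);
`reflectedFloor_le_partitionFn_spinSector_hubbardOpenBoxTT'_re`, `typeFreeEntropy_reflectedFloor` (`TorusSectorPressureTypeBoundParticleHole`);
the `t'`/`U` transport chain of `TypeClassSidecarReaderTPrimeUBox`. `rg 'particleHole' Literature/MathematicalPhysics/QuantumLattice/TypeClass*`
(2026-08-27): nothing — no row-format electron-doped reader before this file.

## References

* E. H. Lieb, F. Y. Wu, Physica A 321 (2003) 1–27, §1 eq. (3) (particle–hole transformation). [cite: LiebWuPhysicaA2003, §1 eq. (3)]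
* D. Ruelle, *Statistical Mechanics: Rigorous Results* (1969), §3.3 eqs. (3.11)–(3.18). [cite: Ruelle1969, §3.3 (3.11)–(3.18)]
* R. B. Israel, *Convexity in the Theory of Lattice Gases* (1979), Lemma II.3.1. [cite: Israel1979, Lemma II.3.1]
* T. M. Cover, J. A. Thomas, *Elements of Information Theory* (2006), Thm. 11.1.3. [cite: CoverThomas2006, Theorem 11.1.3]
* D. Poulin, M. B. Hastings, Phys. Rev. Lett. 106 (2011) 080403, eqs. (3)–(8). [cite: PoulinHastings2011, eqs. (3)–(8)]
-/

noncomputable section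

namespace Literature.MathematicalPhysics.QuantumLattice

open Matrix Finset HubbardWave0 ThermodynamicLimit LiebThm1 AndersonCluster Literature.Probability.LatticeModels
open _root_.Filter
open scoped _root_.Topology ComplexOrder BigOperators

namespace InfVolFermionState

variable {t s U n β : ℝ} {ω : InfVolFermionState 2} {Ls : ℕ → ℕ}

/-! ### §1 The chord floor on the electron-doped side from two checked types on a reflected skeleton -/

/-- **Electron-doped C2 pressure floor at an interpolated density from TWO checked row lists on a REFLECTED skeleton, every torus.**
Row lists `rows₁`, `rows₂` in electron-side sector coordinates (`c2Check` with `(q₁, A₁, W₁)`, `(q₂, A₂, W₂)`, `A₁q₂ ≤ A₂q₁`, common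
skeleton, sectors `≤ ab` componentwise) whose claim node is the HOLE-doped node of `H^open_{a×b}(t, sh, U)` read at the reflected sectors
`(ab − N↑, ab − N↓)`; `λ ∈ [0, 1]`, `n q₁q₂ab = 2((1−λ)A₁q₂ + λA₂q₁)`, `n < 2`. Then along any `Ls → ∞`, for the model `H(t, −sh, U)`:
`∀ ε > 0, ∀ᶠ j, ((((1−λ)W₁ + λW₂) + βU(1 − n)) − ε)(Ls j)² ≤ log Re Z_β(sectorHamiltonianTT' t (−sh) U n (Ls j))`.
[cite: LiebWuPhysicaA2003, §1 eq. (3)] [cite: Ruelle1969, §3.3 (3.11)–(3.18)] [cite: CoverThomas2006, Theorem 11.1.3] -/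
theorem eventually_pressureFloor_chord_of_c2Check₂_particleHole (t sh U n : ℝ) {β : ℝ} (hβ : 0 ≤ β) {a b : ℕ}
    (ha : 1 ≤ a) (hb : 1 ≤ b) {rows₁ rows₂ : List C2Row} {P₁ K₁ P₂ K₂ q₁ q₂ A₁ A₂ : ℕ} {W₁num W₂num : ℤ}
    {W₁den W₂den : ℕ}
    (h₁ : c2Check P₁ K₁ q₁ A₁ a b rows₁ W₁num W₁den = true) (h₂ : c2Check P₂ K₂ q₂ A₂ a b rows₂ W₂num W₂den = true)
    (hskel : rows₁.map (fun r => (r.sec, r.zn, r.ze)) = rows₂.map (fun r => (r.sec, r.zn, r.ze)))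
    (hsec : ∀ r ∈ rows₁, r.nu ≤ a * b ∧ r.nd ≤ a * b)
    (hρ : A₁ * q₂ ≤ A₂ * q₁) {lam : ℝ} (hlam0 : 0 ≤ lam) (hlam1 : lam ≤ 1)
    (hn : n * ((q₁ : ℝ) * q₂ * a * b) = 2 * ((1 - lam) * A₁ * q₂ + lam * A₂ * q₁)) (hn2 : n < 2)
    (hnode : ∀ r ∈ rows₁, r.floor ≤
      (partitionFn β (spinSectorHamiltonian (a * b - r.nu) (a * b - r.nd) (hubbardOpenBoxTT' a b t sh U))).re)
    (hLs : Tendsto Ls atTop atTop) {ε : ℝ} (hε : 0 < ε) :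
    ∀ᶠ j in atTop, ((((1 - lam) * ((W₁num : ℝ) / W₁den) + lam * ((W₂num : ℝ) / W₂den)) + β * U * (1 - n)) - ε) *
        (Ls j : ℝ) ^ 2 ≤ Real.log (partitionFn β (sectorHamiltonianTT' t (-sh) U n (Ls j))).re := by
  obtain ⟨hnd₁, hq₁, hm₁S, hsum₁, hA₁, hB₁, hz0, hW₁⟩ := c2Check_sound h₁ ha hb
  obtain ⟨-, hq₂, hm₂S, hsum₂, hA₂, hB₂, -, hW₂⟩ := c2Check_sound h₂ ha hb
  have hS := c2Sectors_eq_of_skeleton_eq hskel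
  have hF := c2Floor_eq_of_skeleton_eq hskel
  rw [← hS] at hm₂S hsum₂ hA₂ hB₂ hW₂
  rw [← hF] at hW₂
  -- the sectors are inside the cluster
  have hSab : ∀ s ∈ c2Sectors rows₁, s.1 ≤ a * b ∧ s.2 ≤ a * b := by
    intro s hs
    unfold c2Sectors at hs
    rw [List.mem_toFinset, List.mem_map] at hs
    obtain ⟨r, hr, rfl⟩ := hs
    exact hsec r hr
  -- the hole-doped node read at the reflected sectors, then reflected into electron-side floors
  have hzraw : ∀ s ∈ c2Sectors rows₁, c2Floor rows₁ s ≤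
      (partitionFn β (spinSectorHamiltonian (a * b - s.1) (a * b - s.2) (hubbardOpenBoxTT' a b t (-(-sh)) U))).re := by
    rw [neg_neg]
    exact c2Floor_le_of_rows hnd₁
      (F := fun s => (partitionFn β (spinSectorHamiltonian (a * b - s.1) (a * b - s.2) (hubbardOpenBoxTT' a b t sh U))).re)
      fun r hr => hnode r hr
  have hzr0 : ∀ s ∈ c2Sectors rows₁, 0 < Real.exp (β * U * ((a : ℝ) * b - s.1 - s.2)) * c2Floor rows₁ s :=
    fun s hs => mul_pos (Real.exp_pos _) (hz0 s hs)
  have hzr := reflectedFloor_le_partitionFn_spinSector_hubbardOpenBoxTT'_re β t (-sh) U a b hSab hzraw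
  -- the chord floor with the reflected floors
  have hmain := eventually_typeFreeEntropy_chord_mul_sq_le_log_partitionFn_allTori t (-sh) U n hβ ha hb
    (c2Sectors rows₁) (c2Type rows₁) (c2Type rows₂) hq₁ hq₂ hm₁S hm₂S hsum₁ hsum₂ hA₁ hB₁ hA₂ hB₂ hρ hlam0 hlam1
    hn hn2 hzr0 hzr hLs hε
  -- the two type values reflect with the shifts `βU(1 − ρᵢ)`
  have hq₁r : (0 : ℝ) < q₁ := by exact_mod_cast hq₁
  have hq₂r : (0 : ℝ) < q₂ := by exact_mod_cast hq₂
  have har : (0 : ℝ) < a := by exact_mod_cast ha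
  have hbr : (0 : ℝ) < b := by exact_mod_cast hb
  have hρ₁ : (2 * (A₁ : ℝ) / ((q₁ : ℝ) * a * b)) * ((q₁ : ℝ) * a * b) = 2 * A₁ := by
    field_simp
  have hρ₂ : (2 * (A₂ : ℝ) / ((q₂ : ℝ) * a * b)) * ((q₂ : ℝ) * a * b) = 2 * A₂ := by
    field_simp
  have e₁ := typeFreeEntropy_reflectedFloor β U (2 * (A₁ : ℝ) / ((q₁ : ℝ) * a * b)) ha hb (c2Type rows₁) hq₁ hsum₁ hA₁ hB₁
    hρ₁ hz0
  have e₂ := typeFreeEntropy_reflectedFloor β U (2 * (A₂ : ℝ) / ((q₂ : ℝ) * a * b)) ha hb (c2Type rows₂) hq₂ hsum₂ hA₂ hB₂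
    hρ₂ hz0
  rw [e₁, e₂] at hmain
  -- `(1−λ)ρ₁ + λρ₂ = n`
  have hnlam : (1 - lam) * (2 * (A₁ : ℝ) / ((q₁ : ℝ) * a * b)) + lam * (2 * (A₂ : ℝ) / ((q₂ : ℝ) * a * b)) = n := by
    have hpos : (q₁ : ℝ) * q₂ * a * b ≠ 0 := by positivity
    field_simp
    linarith [hn]
  filter_upwards [hmain] with j hj
  refine le_trans (mul_le_mul_of_nonneg_right ?_ (sq_nonneg _)) hj
  have h1 := mul_le_mul_of_nonneg_left hW₁ (sub_nonneg.2 hlam1)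
  have h2 := mul_le_mul_of_nonneg_left hW₂ hlam0
  have hshift : (1 - lam) * (β * U * (1 - 2 * (A₁ : ℝ) / ((q₁ : ℝ) * a * b))) +
      lam * (β * U * (1 - 2 * (A₂ : ℝ) / ((q₂ : ℝ) * a * b))) = β * U * (1 - n) := by
    rw [← hnlam]; ring
  nlinarith [h1, h2, hshift]

/-- **The same floor indexed by the electron density `n ∈ [ρ₁, ρ₂]`** (`ρ_i (q_i a b) = 2A_i`, `ρ₁ < ρ₂`, `n < 2`): along any `Ls → ∞`,
`∀ ε > 0, ∀ᶠ j, (((W₁ + (n − ρ₁)/(ρ₂ − ρ₁)(W₂ − W₁)) + βU(1 − n)) − ε)(Ls j)² ≤ log Re Z_β(sectorHamiltonianTT' t (−sh) U n (Ls j))`.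
[cite: LiebWuPhysicaA2003, §1 eq. (3)] [cite: Ruelle1969, §3.3 (3.11)–(3.18)] -/
theorem eventually_pressureFloor_chord_of_c2Check₂_particleHole_of_mem_Icc (t sh U n : ℝ) {β : ℝ} (hβ : 0 ≤ β)
    {a b : ℕ} (ha : 1 ≤ a) (hb : 1 ≤ b) {rows₁ rows₂ : List C2Row} {P₁ K₁ P₂ K₂ q₁ q₂ A₁ A₂ : ℕ} {W₁num W₂num : ℤ}
    {W₁den W₂den : ℕ}
    (h₁ : c2Check P₁ K₁ q₁ A₁ a b rows₁ W₁num W₁den = true) (h₂ : c2Check P₂ K₂ q₂ A₂ a b rows₂ W₂num W₂den = true)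
    (hskel : rows₁.map (fun r => (r.sec, r.zn, r.ze)) = rows₂.map (fun r => (r.sec, r.zn, r.ze)))
    (hsec : ∀ r ∈ rows₁, r.nu ≤ a * b ∧ r.nd ≤ a * b)
    {ρ₁ ρ₂ : ℝ} (hρ₁ : ρ₁ * ((q₁ : ℝ) * a * b) = 2 * A₁) (hρ₂ : ρ₂ * ((q₂ : ℝ) * a * b) = 2 * A₂) (hρ : ρ₁ < ρ₂)
    (hn1 : ρ₁ ≤ n) (hn2' : n ≤ ρ₂) (hn2 : n < 2)
    (hnode : ∀ r ∈ rows₁, r.floor ≤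
      (partitionFn β (spinSectorHamiltonian (a * b - r.nu) (a * b - r.nd) (hubbardOpenBoxTT' a b t sh U))).re)
    (hLs : Tendsto Ls atTop atTop) {ε : ℝ} (hε : 0 < ε) :
    ∀ᶠ j in atTop, (((((W₁num : ℝ) / W₁den) + (n - ρ₁) / (ρ₂ - ρ₁) * (((W₂num : ℝ) / W₂den) - ((W₁num : ℝ) / W₁den))) +
        β * U * (1 - n)) - ε) * (Ls j : ℝ) ^ 2 ≤ Real.log (partitionFn β (sectorHamiltonianTT' t (-sh) U n (Ls j))).re := by
  obtain ⟨-, hq₁, -⟩ := c2Check_sound h₁ ha hb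
  obtain ⟨-, hq₂, -⟩ := c2Check_sound h₂ ha hb
  have hq₁r : (0 : ℝ) < q₁ := by exact_mod_cast hq₁
  have hq₂r : (0 : ℝ) < q₂ := by exact_mod_cast hq₂
  have har : (0 : ℝ) < a := by exact_mod_cast ha
  have hbr : (0 : ℝ) < b := by exact_mod_cast hb
  set lam : ℝ := (n - ρ₁) / (ρ₂ - ρ₁) with hlam
  have hd : 0 < ρ₂ - ρ₁ := sub_pos.2 hρ
  have hlam0 : 0 ≤ lam := div_nonneg (sub_nonneg.2 hn1) hd.le
  have hlam1 : lam ≤ 1 := (div_le_one hd).2 (by linarith)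
  have hnlam : n = (1 - lam) * ρ₁ + lam * ρ₂ := by
    rw [hlam]; field_simp; ring
  have hρnat : A₁ * q₂ ≤ A₂ * q₁ := by
    have h1 : (ρ₁ : ℝ) * ((q₁ : ℝ) * a * b) * q₂ ≤ ρ₂ * ((q₂ : ℝ) * a * b) * q₁ := by
      have : ρ₁ * ((q₁ : ℝ) * a * b) * q₂ - ρ₂ * ((q₂ : ℝ) * a * b) * q₁ = (ρ₁ - ρ₂) * (q₁ * q₂ * a * b) := by ring
      nlinarith [mul_pos (mul_pos (mul_pos hq₁r hq₂r) har) hbr]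
    rw [hρ₁, hρ₂] at h1
    have h2 : ((A₁ * q₂ : ℕ) : ℝ) ≤ ((A₂ * q₁ : ℕ) : ℝ) := by push_cast; linarith
    exact_mod_cast h2
  have hn : n * ((q₁ : ℝ) * q₂ * a * b) = 2 * ((1 - lam) * A₁ * q₂ + lam * A₂ * q₁) := by
    have e1 : 2 * ((1 - lam) * (A₁ : ℝ) * q₂ + lam * A₂ * q₁) =
        (1 - lam) * (2 * (A₁ : ℝ)) * q₂ + lam * (2 * (A₂ : ℝ)) * q₁ := by ring
    rw [e1, ← hρ₁, ← hρ₂, hnlam]; ring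
  have hmain := eventually_pressureFloor_chord_of_c2Check₂_particleHole t sh U n hβ ha hb h₁ h₂ hskel hsec hρnat hlam0
    hlam1 hn hn2 hnode hLs hε
  filter_upwards [hmain] with j hj
  refine le_trans (le_of_eq ?_) hj
  congr 1
  rw [hlam]
  ring

/-! ### §2 The electron-doped 3-CELL reader: one anchor `(s₀, U₀) = (−sh, U₀)` × filling interval `[ρ₁, ρ₂]` -/

/-- **ELECTRON-DOPED `(t', U, n)`-CELL from ONE hole-doped sidecar (of `H^open(t, sh, U₀)`) and TWO checked types on its reflected skeleton**,
`t' = 0` CORNER Markov certificate at `(β_h, μ, U₀)`; for every torus limit of `H(t, s, U)` at `(β, n)` with `|s| ≤ σ₁`, `|s − (−sh)| ≤ σ₂`,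
`ρ₁ ≤ n ≤ ρ₂` (`n < 2`, `0 < β_h < β`), along ANY `Ls → ∞` (no parity condition):
`e_Φ(ω) ≤ ((((c − β_hμn) + β_hσ₁16/π²) + β_h·max(U₀−U,0)·n/2) − ((((W₁ + (n−ρ₁)/(ρ₂−ρ₁)(W₂−W₁)) + βU₀(1−n)) − βσ₂16/π²) − β·max(U−U₀,0)·n/2))/(β−β_h)`.
[cite: LiebWuPhysicaA2003, §1 eq. (3)] [cite: Israel1979, Lemma II.3.1] [cite: Ruelle1969, §3.3 (3.11)–(3.18)] [cite: PoulinHastings2011, eqs. (3)–(8)] -/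
theorem IsTorusLimitOfMixture.meanEnergy_hubbardTTPrime_le_of_c2Check₂_particleHole_of_cornerMarkovCertificate_tPrimeUBox_allTori_anchorU_kinematic
    (hn2 : n < 2) (sh : ℝ) {σ₁ σ₂ : ℝ} (hσ₁ : |s| ≤ σ₁) (hσ₂ : |s - (-sh)| ≤ σ₂) (U₀ : ℝ)
    (h : ω.IsTorusLimitOfMixture (sectorGibbsCount n) (fun L => sectorGibbsWeightTT' β t s U n L)
      (fun L => sectorGibbsVectorTT' t s U n L) Ls)
    (hLs : Tendsto Ls atTop atTop) {βh : ℝ} (hβh : 0 < βh) (hlt : βh < β)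
    -- C2: hole-doped sidecar of `H^open(t, sh, U₀)`, two checked types on the reflected skeleton
    {a b : ℕ} (ha : 1 ≤ a) (hb : 1 ≤ b) {rows₁ rows₂ : List C2Row} {P₁ K₁ P₂ K₂ q₁ q₂ A₁ A₂ : ℕ}
    {W₁num W₂num : ℤ} {W₁den W₂den : ℕ}
    (h₁ : c2Check P₁ K₁ q₁ A₁ a b rows₁ W₁num W₁den = true) (h₂ : c2Check P₂ K₂ q₂ A₂ a b rows₂ W₂num W₂den = true)
    (hskel : rows₁.map (fun r => (r.sec, r.zn, r.ze)) = rows₂.map (fun r => (r.sec, r.zn, r.ze)))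
    (hsec : ∀ r ∈ rows₁, r.nu ≤ a * b ∧ r.nd ≤ a * b)
    {ρ₁ ρ₂ : ℝ} (hρ₁ : ρ₁ * ((q₁ : ℝ) * a * b) = 2 * A₁) (hρ₂ : ρ₂ * ((q₂ : ℝ) * a * b) = 2 * A₂) (hρ : ρ₁ < ρ₂)
    (hn1 : ρ₁ ≤ n) (hn2' : n ≤ ρ₂)
    (hnode : ∀ r ∈ rows₁, r.floor ≤
      (partitionFn β (spinSectorHamiltonian (a * b - r.nu) (a * b - r.nd) (hubbardOpenBoxTT' a b t sh U₀))).re)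
    -- C1 (corner window, `t' = 0`) at `(βh, μ, U₀)`
    (μ : ℝ) {Λ : Finset (Site 2)} {x₀ : Site 2} (hx₀ : x₀ ∈ Λ) (hmax : ∀ y ∈ Λ, toLex y ≤ toLex x₀)
    (hcorner : ∀ i : Fin 2, x₀ - unitVec i ∈ Λ) {ℓw : ℕ} (hΛ : Λ ⊆ halfOpenBox 2 ℓw)
    {ι : Type*} (sι : Finset ι) (Sw : ι → Finset (Site 2)) (hS : ∀ i, Sw i ⊆ Λ) (zw : ι → Site 2)
    (hzw : ∀ i, shiftSet (zw i) (Sw i) ⊆ Λ) {O : ∀ i, FermionOp (Sw i)} (hO : ∀ i ∈ sι, (O i).IsHermitian)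
    (g : ι → ℝ) {LB : FermionOp (Λ.erase x₀)} (hLB : LB.IsHermitian) {c : ℝ}
    (hcert : ((Real.exp c : ℂ) • cfc Real.exp LB -
      fermionPartialTrace (PolySite.incl (Finset.erase_subset x₀ Λ))
        (cfc Real.exp (-((βh : ℂ) • (cornerEnergyRep Λ x₀ t U₀ μ + windowAnnihilator sι Λ Sw hS zw hzw O g)) +
          fermionEmbed (PolySite.incl (Finset.erase_subset x₀ Λ)) LB))).PosSemidef) :
    ω.meanEnergy (hubbardTTPrimeFermionInteraction t s U) 1 ≤
      ((((c - βh * μ * n) + βh * σ₁ * (16 / Real.pi ^ 2)) + βh * max (U₀ - U) 0 * (n / 2)) -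
        ((((((W₁num : ℝ) / W₁den) + (n - ρ₁) / (ρ₂ - ρ₁) * (((W₂num : ℝ) / W₂den) - ((W₁num : ℝ) / W₁den))) +
            β * U₀ * (1 - n)) - β * σ₂ * (16 / Real.pi ^ 2)) - β * max (U - U₀) 0 * (n / 2))) / (β - βh) := by
  obtain ⟨-, hq₁, -⟩ := c2Check_sound h₁ ha hb
  have hn0 : 0 ≤ n := by
    have hq₁r : (0 : ℝ) < q₁ := by exact_mod_cast hq₁
    have har : (0 : ℝ) < a := by exact_mod_cast ha
    have hbr : (0 : ℝ) < b := by exact_mod_cast hb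
    have hpos : 0 < (q₁ : ℝ) * a * b := by positivity
    have hA : (0 : ℝ) ≤ 2 * A₁ := by positivity
    have hρ₁0 : 0 ≤ ρ₁ := (mul_nonneg_iff_of_pos_right hpos).1 (by rw [hρ₁]; exact hA)
    linarith
  have hβ : 0 < β := hβh.trans hlt
  have hK0 : 0 ≤ 16 / Real.pi ^ 2 := by positivity
  set Wc : ℝ := (((W₁num : ℝ) / W₁den) + (n - ρ₁) / (ρ₂ - ρ₁) * (((W₂num : ℝ) / W₂den) - ((W₁num : ℝ) / W₁den))) +
    β * U₀ * (1 - n) with hWc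
  -- cold input at `(β, t, −sh, U₀)`: the reflected chord floor, then transported along `t'`
  have hW0 : ∀ ε : ℝ, 0 < ε → ∀ᶠ j in atTop,
      (Wc - ε) * (Ls j : ℝ) ^ 2 ≤ Real.log (partitionFn β (sectorHamiltonianTT' t (-sh) U₀ n (Ls j))).re :=
    fun ε hε => eventually_pressureFloor_chord_of_c2Check₂_particleHole_of_mem_Icc t sh U₀ n hβ.le ha hb h₁ h₂ hskel hsec
      hρ₁ hρ₂ hρ hn1 hn2' hn2 hnode hLs hε
  have hWs := eventually_mul_sq_le_log_partitionFn_sector_of_tPrime_anchor_floor hn0 hn2 t U₀ hβ (-sh) s hLs hW0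
  have hWs' : ∀ ε : ℝ, 0 < ε → ∀ᶠ j in atTop,
      ((Wc - β * σ₂ * (16 / Real.pi ^ 2)) - ε) * (Ls j : ℝ) ^ 2 ≤
        Real.log (partitionFn β (sectorHamiltonianTT' t s U₀ n (Ls j))).re := by
    intro ε hε
    filter_upwards [hWs ε hε] with j hj
    refine le_trans (mul_le_mul_of_nonneg_right ?_ (sq_nonneg _)) hj
    have h2 : β * |s - (-sh)| * (16 / Real.pi ^ 2) ≤ β * σ₂ * (16 / Real.pi ^ 2) :=
      mul_le_mul_of_nonneg_right (mul_le_mul_of_nonneg_left hσ₂ hβ.le) hK0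
    linarith
  -- hot input at `(βh, t, s, U₀)`: corner C1 transported along `t'`
  have hu := eventually_log_partitionFn_sector_le_of_cornerMarkovCertificate_tPrimeTransport hn0 hn2 t s U₀ hβh hLs μ hx₀ hmax
    hcorner hΛ sι Sw hS zw hzw hO g hLB hcert
  have hu' : ∀ ε : ℝ, 0 < ε → ∀ᶠ j in atTop,
      Real.log (partitionFn βh (sectorHamiltonianTT' t s U₀ n (Ls j))).re ≤
        (((c - βh * μ * n) + βh * σ₁ * (16 / Real.pi ^ 2)) + ε) * (Ls j : ℝ) ^ 2 := by
    intro ε hε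
    filter_upwards [hu ε hε] with j hj
    refine hj.trans (mul_le_mul_of_nonneg_right ?_ (sq_nonneg _))
    have h1 : βh * |s| * (16 / Real.pi ^ 2) ≤ βh * σ₁ * (16 / Real.pi ^ 2) :=
      mul_le_mul_of_nonneg_right (mul_le_mul_of_nonneg_left hσ₁ hβh.le) hK0
    linarith
  exact h.meanEnergy_hubbardTTPrime_le_of_pressure_bounds_anchorU_kinematic hn0 hn2.le U₀ hLs hβh hlt hWs' hu'

/-- **Rectangle corollary, row-file edition** of the electron-doped 3-cell reader (`16/π²` replaced by `16212/10000`).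
[cite: LiebWuPhysicaA2003, §1 eq. (3)] [cite: Israel1979, Lemma II.3.1] [cite: PoulinHastings2011, eqs. (3)–(8)] -/
theorem IsTorusLimitOfMixture.meanEnergy_hubbardTTPrime_le_of_c2Check₂_particleHole_of_rectMarkovCertificate_tPrimeUBox_allTori_anchorU_kinematic'
    (hn2 : n < 2) (sh : ℝ) {σ₁ σ₂ : ℝ} (hσ₁ : |s| ≤ σ₁) (hσ₂ : |s - (-sh)| ≤ σ₂) (U₀ : ℝ)
    (h : ω.IsTorusLimitOfMixture (sectorGibbsCount n) (fun L => sectorGibbsWeightTT' β t s U n L)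
      (fun L => sectorGibbsVectorTT' t s U n L) Ls)
    (hLs : Tendsto Ls atTop atTop) {βh : ℝ} (hβh : 0 < βh) (hlt : βh < β)
    {a b : ℕ} (ha : 1 ≤ a) (hb : 1 ≤ b) {rows₁ rows₂ : List C2Row} {P₁ K₁ P₂ K₂ q₁ q₂ A₁ A₂ : ℕ}
    {W₁num W₂num : ℤ} {W₁den W₂den : ℕ}
    (h₁ : c2Check P₁ K₁ q₁ A₁ a b rows₁ W₁num W₁den = true) (h₂ : c2Check P₂ K₂ q₂ A₂ a b rows₂ W₂num W₂den = true)
    (hskel : rows₁.map (fun r => (r.sec, r.zn, r.ze)) = rows₂.map (fun r => (r.sec, r.zn, r.ze)))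
    (hsec : ∀ r ∈ rows₁, r.nu ≤ a * b ∧ r.nd ≤ a * b)
    {ρ₁ ρ₂ : ℝ} (hρ₁ : ρ₁ * ((q₁ : ℝ) * a * b) = 2 * A₁) (hρ₂ : ρ₂ * ((q₂ : ℝ) * a * b) = 2 * A₂) (hρ : ρ₁ < ρ₂)
    (hn1 : ρ₁ ≤ n) (hn2' : n ≤ ρ₂)
    (hnode : ∀ r ∈ rows₁, r.floor ≤
      (partitionFn β (spinSectorHamiltonian (a * b - r.nu) (a * b - r.nd) (hubbardOpenBoxTT' a b t sh U₀))).re)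
    (μ : ℝ) {a' b' : ℕ} (ha' : 2 ≤ a') (hb' : 2 ≤ b')
    {ι : Type*} (sι : Finset ι) (Sw : ι → Finset (Site 2)) (hS : ∀ i, Sw i ⊆ rectWindow a' b') (zw : ι → Site 2)
    (hzw : ∀ i, shiftSet (zw i) (Sw i) ⊆ rectWindow a' b') {O : ∀ i, FermionOp (Sw i)}
    (hO : ∀ i ∈ sι, (O i).IsHermitian) (g : ι → ℝ)
    {LB : FermionOp ((rectWindow a' b').erase (mkSite2 (a' - 1) (b' - 1)))} (hLB : LB.IsHermitian) {c : ℝ}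
    (hcert : ((Real.exp c : ℂ) • cfc Real.exp LB -
      fermionPartialTrace (PolySite.incl (Finset.erase_subset (mkSite2 (a' - 1) (b' - 1)) (rectWindow a' b')))
        (cfc Real.exp (-((βh : ℂ) • (cornerEnergyRep (rectWindow a' b') (mkSite2 (a' - 1) (b' - 1)) t U₀ μ +
            windowAnnihilator sι (rectWindow a' b') Sw hS zw hzw O g)) +
          fermionEmbed (PolySite.incl (Finset.erase_subset (mkSite2 (a' - 1) (b' - 1)) (rectWindow a' b'))) LB))).PosSemidef) :
    ω.meanEnergy (hubbardTTPrimeFermionInteraction t s U) 1 ≤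
      ((((c - βh * μ * n) + βh * σ₁ * (16212 / 10000)) + βh * max (U₀ - U) 0 * (n / 2)) -
        ((((((W₁num : ℝ) / W₁den) + (n - ρ₁) / (ρ₂ - ρ₁) * (((W₂num : ℝ) / W₂den) - ((W₁num : ℝ) / W₁den))) +
            β * U₀ * (1 - n)) - β * σ₂ * (16212 / 10000)) - β * max (U - U₀) 0 * (n / 2))) / (β - βh) := by
  have hmain := h.meanEnergy_hubbardTTPrime_le_of_c2Check₂_particleHole_of_cornerMarkovCertificate_tPrimeUBox_allTori_anchorU_kinematic
    hn2 sh hσ₁ hσ₂ U₀ hLs hβh hlt ha hb h₁ h₂ hskel hsec hρ₁ hρ₂ hρ hn1 hn2' hnode μ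
    (rectCorner_mem_rectWindow (by omega) (by omega)) toLex_le_toLex_rectCorner (rectCorner_sub_unitVec_mem_rectWindow ha' hb')
    (rectWindow_subset_halfOpenBox_max a' b') sι Sw hS zw hzw hO g hLB hcert
  refine hmain.trans (div_le_div_of_nonneg_right ?_ (by linarith))
  have hK := sixteen_div_pi_sq_lt.le
  have hσ₁0 : 0 ≤ σ₁ := (abs_nonneg s).trans hσ₁
  have hσ₂0 : 0 ≤ σ₂ := (abs_nonneg _).trans hσ₂
  have h1 := mul_le_mul_of_nonneg_left hK (mul_nonneg hβh.le hσ₁0)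
  have h2 := mul_le_mul_of_nonneg_left hK (mul_nonneg (hβh.trans hlt).le hσ₂0)
  linarith

/-! ### §3 The C2-ONLY (infinite-temperature anchor) electron-doped reader on the half-line `U ≤ U₀` and the `t'`-box: NO C1, NO `U`-price -/

/-- **Electron-doped cap from the reflected chord floor ALONE** (hot anchor = the exact `β = 0` sector entropy): for every torus limit of
`H(t, s, U)` at `(β, n)` with `U ≤ U₀`, `|s − (−sh)| ≤ σ₂`, `ρ₁ ≤ n ≤ ρ₂ < 2`, along ANY `Ls → ∞`, and every `s_e > 2H_b(n/2)`:
`e_Φ(ω) ≤ (s_e − (((W₁ + (n−ρ₁)/(ρ₂−ρ₁)(W₂−W₁)) + βU₀(1−n)) − βσ₂·16/π²))/β` (the floor is free below the sidecar's `U₀` and moves along `t'` at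
the kinematic price; no Markov certificate — whose `μ` is tuned to hole doping — enters). [cite: LiebWuPhysicaA2003, §1 eq. (3)]
[cite: Israel1979, Lemma II.3.1] [cite: Israel1979, Thm. I.3.4] [cite: Ruelle1969, §3.3 (3.11)–(3.18)] -/
theorem IsTorusLimitOfMixture.meanEnergy_hubbardTTPrime_le_of_c2Check₂_particleHole_infT_tPrime_allTori_of_le_U
    (hn2 : n < 2) (sh : ℝ) {σ₂ : ℝ} (hσ₂ : |s - (-sh)| ≤ σ₂) {U₀ : ℝ} (hU : U ≤ U₀)
    (h : ω.IsTorusLimitOfMixture (sectorGibbsCount n) (fun L => sectorGibbsWeightTT' β t s U n L)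
      (fun L => sectorGibbsVectorTT' t s U n L) Ls)
    (hLs : Tendsto Ls atTop atTop) (hβ : 0 < β)
    {a b : ℕ} (ha : 1 ≤ a) (hb : 1 ≤ b) {rows₁ rows₂ : List C2Row} {P₁ K₁ P₂ K₂ q₁ q₂ A₁ A₂ : ℕ}
    {W₁num W₂num : ℤ} {W₁den W₂den : ℕ}
    (h₁ : c2Check P₁ K₁ q₁ A₁ a b rows₁ W₁num W₁den = true) (h₂ : c2Check P₂ K₂ q₂ A₂ a b rows₂ W₂num W₂den = true)
    (hskel : rows₁.map (fun r => (r.sec, r.zn, r.ze)) = rows₂.map (fun r => (r.sec, r.zn, r.ze)))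
    (hsec : ∀ r ∈ rows₁, r.nu ≤ a * b ∧ r.nd ≤ a * b)
    {ρ₁ ρ₂ : ℝ} (hρ₁ : ρ₁ * ((q₁ : ℝ) * a * b) = 2 * A₁) (hρ₂ : ρ₂ * ((q₂ : ℝ) * a * b) = 2 * A₂) (hρ : ρ₁ < ρ₂)
    (hn1 : ρ₁ ≤ n) (hn2' : n ≤ ρ₂)
    (hnode : ∀ r ∈ rows₁, r.floor ≤
      (partitionFn β (spinSectorHamiltonian (a * b - r.nu) (a * b - r.nd) (hubbardOpenBoxTT' a b t sh U₀))).re)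
    {se : ℝ} (hs : 2 * Real.binEntropy (n / 2) < se) :
    ω.meanEnergy (hubbardTTPrimeFermionInteraction t s U) 1 ≤
      (se - (((((W₁num : ℝ) / W₁den) + (n - ρ₁) / (ρ₂ - ρ₁) * (((W₂num : ℝ) / W₂den) - ((W₁num : ℝ) / W₁den))) +
        β * U₀ * (1 - n)) - β * σ₂ * (16 / Real.pi ^ 2))) / β := by
  obtain ⟨-, hq₁, -⟩ := c2Check_sound h₁ ha hb
  have hn0 : 0 ≤ n := by
    have hq₁r : (0 : ℝ) < q₁ := by exact_mod_cast hq₁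
    have har : (0 : ℝ) < a := by exact_mod_cast ha
    have hbr : (0 : ℝ) < b := by exact_mod_cast hb
    have hpos : 0 < (q₁ : ℝ) * a * b := by positivity
    have hA : (0 : ℝ) ≤ 2 * A₁ := by positivity
    have hρ₁0 : 0 ≤ ρ₁ := (mul_nonneg_iff_of_pos_right hpos).1 (by rw [hρ₁]; exact hA)
    linarith
  have hK0 : 0 ≤ 16 / Real.pi ^ 2 := by positivity
  set Wc : ℝ := (((W₁num : ℝ) / W₁den) + (n - ρ₁) / (ρ₂ - ρ₁) * (((W₂num : ℝ) / W₂den) - ((W₁num : ℝ) / W₁den))) +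
    β * U₀ * (1 - n) with hWc
  have hW0 : ∀ ε : ℝ, 0 < ε → ∀ᶠ j in atTop,
      (Wc - ε) * (Ls j : ℝ) ^ 2 ≤ Real.log (partitionFn β (sectorHamiltonianTT' t (-sh) U₀ n (Ls j))).re :=
    fun ε hε => eventually_pressureFloor_chord_of_c2Check₂_particleHole_of_mem_Icc t sh U₀ n hβ.le ha hb h₁ h₂ hskel hsec
      hρ₁ hρ₂ hρ hn1 hn2' hn2 hnode hLs hε
  have hWs := eventually_mul_sq_le_log_partitionFn_sector_of_tPrime_anchor_floor hn0 hn2 t U₀ hβ (-sh) s hLs hW0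
  -- move to `U ≤ U₀` for free and weaken `|s + sh| ≤ σ₂`
  have hWU : ∀ ε : ℝ, 0 < ε → ∀ᶠ j in atTop,
      ((Wc - β * σ₂ * (16 / Real.pi ^ 2)) - ε) * (Ls j : ℝ) ^ 2 ≤
        Real.log (partitionFn β (sectorHamiltonianTT' t s U n (Ls j))).re := by
    intro ε hε
    have hX := eventually_le_log_partitionFn_sectorHamiltonianTT'_of_le_U hn0 hn2.le t s hβ.le hU hLs (hWs ε hε)
    filter_upwards [hX] with j hj
    refine le_trans (mul_le_mul_of_nonneg_right ?_ (sq_nonneg _)) hj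
    have h2 : β * |s - (-sh)| * (16 / Real.pi ^ 2) ≤ β * σ₂ * (16 / Real.pi ^ 2) :=
      mul_le_mul_of_nonneg_right (mul_le_mul_of_nonneg_left hσ₂ hβ.le) hK0
    linarith
  have hcount : ∀ᶠ j in atTop, Real.log (sectorGibbsCount n (Ls j)) ≤ se * (Ls j : ℝ) ^ 2 :=
    hLs.eventually (eventually_log_sectorGibbsCount_le hn0 hn2.le hs)
  exact h.meanEnergy_hubbardTTPrime_le_entropy_sub_div_of_sectorGibbs_of_forall_pos hn0 hn2.le hLs hβ hWU hcount

/-- **Row-file edition** of the C2-only electron-doped reader (`16/π²` replaced by `16212/10000`).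
[cite: LiebWuPhysicaA2003, §1 eq. (3)] [cite: Israel1979, Lemma II.3.1] [cite: Israel1979, Thm. I.3.4] -/
theorem IsTorusLimitOfMixture.meanEnergy_hubbardTTPrime_le_of_c2Check₂_particleHole_infT_tPrime_allTori_of_le_U'
    (hn2 : n < 2) (sh : ℝ) {σ₂ : ℝ} (hσ₂ : |s - (-sh)| ≤ σ₂) {U₀ : ℝ} (hU : U ≤ U₀)
    (h : ω.IsTorusLimitOfMixture (sectorGibbsCount n) (fun L => sectorGibbsWeightTT' β t s U n L)
      (fun L => sectorGibbsVectorTT' t s U n L) Ls)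
    (hLs : Tendsto Ls atTop atTop) (hβ : 0 < β)
    {a b : ℕ} (ha : 1 ≤ a) (hb : 1 ≤ b) {rows₁ rows₂ : List C2Row} {P₁ K₁ P₂ K₂ q₁ q₂ A₁ A₂ : ℕ}
    {W₁num W₂num : ℤ} {W₁den W₂den : ℕ}
    (h₁ : c2Check P₁ K₁ q₁ A₁ a b rows₁ W₁num W₁den = true) (h₂ : c2Check P₂ K₂ q₂ A₂ a b rows₂ W₂num W₂den = true)
    (hskel : rows₁.map (fun r => (r.sec, r.zn, r.ze)) = rows₂.map (fun r => (r.sec, r.zn, r.ze)))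
    (hsec : ∀ r ∈ rows₁, r.nu ≤ a * b ∧ r.nd ≤ a * b)
    {ρ₁ ρ₂ : ℝ} (hρ₁ : ρ₁ * ((q₁ : ℝ) * a * b) = 2 * A₁) (hρ₂ : ρ₂ * ((q₂ : ℝ) * a * b) = 2 * A₂) (hρ : ρ₁ < ρ₂)
    (hn1 : ρ₁ ≤ n) (hn2' : n ≤ ρ₂)
    (hnode : ∀ r ∈ rows₁, r.floor ≤
      (partitionFn β (spinSectorHamiltonian (a * b - r.nu) (a * b - r.nd) (hubbardOpenBoxTT' a b t sh U₀))).re)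
    {se : ℝ} (hs : 2 * Real.binEntropy (n / 2) < se) :
    ω.meanEnergy (hubbardTTPrimeFermionInteraction t s U) 1 ≤
      (se - (((((W₁num : ℝ) / W₁den) + (n - ρ₁) / (ρ₂ - ρ₁) * (((W₂num : ℝ) / W₂den) - ((W₁num : ℝ) / W₁den))) +
        β * U₀ * (1 - n)) - β * σ₂ * (16212 / 10000))) / β := by
  have hmain := h.meanEnergy_hubbardTTPrime_le_of_c2Check₂_particleHole_infT_tPrime_allTori_of_le_U hn2 sh hσ₂ hU hLs hβ ha hb
    h₁ h₂ hskel hsec hρ₁ hρ₂ hρ hn1 hn2' hnode hs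
  refine hmain.trans (div_le_div_of_nonneg_right ?_ hβ.le)
  have hK := sixteen_div_pi_sq_lt.le
  have hσ₂0 : 0 ≤ σ₂ := (abs_nonneg _).trans hσ₂
  have h2 := mul_le_mul_of_nonneg_left hK (mul_nonneg hβ.le hσ₂0)
  linarith

end InfVolFermionState

end Literature.MathematicalPhysics.QuantumLattice

end
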